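import Summits.QuantumFields.BalabanUV.Beta.CapRowsVertexTori

/-!
# Beta / CapRowsRelabel — the coordinate-relabelling socket for the SYM4 node set (STAGED by a planner seat, NOT PROPOSED; courier = an5)
# (β sub-cell, lineage `b2b-balaban-beta-cap3`, gen 14; CAP-KERNEL v0.7.12 §4.23 (d); CLAIMS l.12339)

HONEST FRAMING (cell rule, page 1).  Discharging `BetaPertH` makes Bałaban's UV stability UNCONDITIONAL — a real constructive-QFT result; it is NOT
the continuum limit and NOT the Clay problem.  HONEST DEPENDENCY: continuum YM on T⁴ ⇐ BetaPertH ∧ nine spine estimates (0/9 proved); BetaPertH ⇐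
(D1) ∧ (D4) ∧ CAP+tail; G-an2-4 gates asym, D1 and NE2/3/4.  KERNEL GLUE ONLY: nothing below instantiates a binder; no `κ, a, M, N, t, r` is
asserted; no certificate is consumed or produced; THIS FILE IS STAGED (cap3 gen 14, `HOME/b2b-balaban-beta-cap3/g14/CapRowsRelabel.lean`), NOT
PROPOSED — it is the courier packet for an5 if the coordinator adopts the relabelled node rule S′ (SYM4).  0 certified coefficients.

WHAT.  The engines' node code `S_E = {w : 4 ∣ w₀+2w₁+w₂, 4 ∣ 2w₀+w₁+w₃}` (`code16SetE`) admits only the symmetry quotient `{±1}` of the lane's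
functional `G` (whose stabiliser in `W(B₄)` is `{1, R₂, R₃, R₂R₃}`, J25 PART D).  The RELABELLED code `S′ = {w : w ∘ σ ∈ S_E}` for the transposition
`σ = (1 2)` is invariant under `R₂R₃` and `−1`, so its node sets quotient by a group of order 4 (representatives 1 092 ∕ 16 644 ∕ 26 569 ∕ 40 404 ∕
83 524 at `N = 4 ∕ 8 ∕ 9 ∕ 10 ∕ 12`).  No new tail theorem is needed: the node mean of `G` over `S′` is the node mean of `G ∘ (· ∘ σ)` over `S_E`
(`descend_relabel_gridPt`, definitional up to `gridPt`'s coordinatewise form), and the generic anchor `rowsOfCode16E_ofVertexTori₂` applies to the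
relabelled function once (L1) `TubeHol` (`tubeHol_relabel`) and (L2) the `x = 0` lattice kernel (`latticeKernel_relabel_zero`) are shown invariant
under coordinate relabelling; the (Z2) bound on `VertexTori (fun _ => κ)` transfers because that set is relabelling-invariant
(`relabel_mem_vertexTori`).  (L1) is Fin-combinatorics — the relabelled coordinate line `(i.insertNth z q) ∘ σ` is the line
`(σ⁻¹ i).insertNth z q′` with `q′ k = (i.insertNth 0 q) (σ ((σ⁻¹ i).succAbove k))` — plus composition with the continuous map `p ↦ p ∘ σ`;
(L2) is the volume-preserving measurable equivalence `MeasurableEquiv.arrowCongr' σ.symm (refl ℝ) = (· ∘ σ)` of the box onto itself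
(`MeasureTheory.volume_preserving_arrowCongr'`, `MeasurePreserving.setIntegral_preimage_emb`).  ROW: `rowsOfCode16Relabel_ofVertexTori₂` =
`CapRowsVertexTori.rowsOfCode16E_ofVertexTori₂` for `relabel σ G`, with (N), STRUCTURE, (Z2), (A), cmp stated for `G` itself and (T) the certified
ball for the node mean of `G` over the relabelled nodes `gridPt (4N) (w ∘ σ)`, `w ∈ code16SetE N`.

COURIER NOTE (an5-g22, 2026-08-20): filed for the author (cap3 gen 14, staged sha16 24dd1102f967a273, journal l.12404) with ONE docstring
added on `relabel_apply` (gate lint `lint.docstring`); code byte-identical otherwise.  Dictionary with `Beta/VertexToriSymmetry`: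
`relabel σ G = G ∘ VertexToriSymmetry.permute σ`.

[folklore]; 0 `sorry`; 0 cite tags.
-/

namespace Summit.QuantumFields.BalabanUV.Beta.CapRowsRelabel

open Literature.MathematicalPhysics.QuantumFieldTheory.Balaban1983to89
open Literature.MathematicalPhysics.QuantumFieldTheory.Balaban1983to89.Beta
open FlowStep FlowStepRuns DagBinding
open B4Strip (Strip ofRealVec)
open B4ContourShift (latticeKernel)
open B4TorusKernel (descend gridPt)
open Beta.AliasingTailL1 (StripRegularC aliasRatioL1)
open Beta.AliasingTailLattice (codeTheta code16SetE)
open Summit.QuantumFields.BalabanUV.Beta.CapRows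
open Summit.QuantumFields.BalabanUV.Beta.CapRowsVertexTori (rowsOfCode16E_ofVertexTori₂)
open Summit.QuantumFields.BalabanUV.Beta.TubeMaximumModulus

noncomputable section

variable {d : ℕ}

/-- relabelling the coordinates of a multiplier by a permutation `σ`: `(relabel σ G) p = G (p ∘ σ)`. [folklore] -/
def relabel (σ : Equiv.Perm (Fin (d + 1))) (G : (Fin (d + 1) → ℂ) → ℂ) : (Fin (d + 1) → ℂ) → ℂ := fun p => G (p ∘ σ)

/-- the value of the relabelled multiplier (definitional). [folklore] -/
@[simp] theorem relabel_apply (σ : Equiv.Perm (Fin (d + 1))) (G : (Fin (d + 1) → ℂ) → ℂ) (p : Fin (d + 1) → ℂ) :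
    relabel σ G p = G (p ∘ σ) := rfl

/-- the vertex tori with equal half-widths are relabelling-invariant. [folklore] -/
theorem relabel_mem_vertexTori {κ : ℝ} (σ : Equiv.Perm (Fin (d + 1))) {p : Fin (d + 1) → ℂ}
    (hp : p ∈ VertexTori (fun _ : Fin (d + 1) => κ)) : (p ∘ σ) ∈ VertexTori (fun _ : Fin (d + 1) => κ) :=
  fun μ => hp (σ μ)

/-- hence a (Z2) bound on the vertex tori transfers to the relabelled function. [folklore] -/
theorem bound_relabel_of_vertexTori {κ M : ℝ} (σ : Equiv.Perm (Fin (d + 1))) {G : (Fin (d + 1) → ℂ) → ℂ}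
    (hM : ∀ p ∈ VertexTori (fun _ : Fin (d + 1) => κ), ‖G p‖ ≤ M) :
    ∀ p ∈ VertexTori (fun _ : Fin (d + 1) => κ), ‖relabel σ G p‖ ≤ M :=
  fun _ hp => hM _ (relabel_mem_vertexTori σ hp)

/-- the node values: `descend (relabel σ G) (gridPt n w) = descend G (gridPt n (w ∘ σ))`. [folklore] -/
theorem descend_relabel_gridPt (σ : Equiv.Perm (Fin (d + 1))) (G : (Fin (d + 1) → ℂ) → ℂ) (n : ℕ) (w : Fin (d + 1) → Fin n) :
    descend (relabel σ G) (gridPt n w) = descend G (gridPt n (w ∘ σ)) := by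
  simp only [descend, relabel_apply]
  rfl

/-- **(L1)** `TubeHol` with equal half-widths is relabelling-invariant (periodicity via `Function.update_comp_equiv`; continuity by composition;
separate holomorphy in slot `i` of `relabel σ G` is separate holomorphy of `G` in slot `σ⁻¹ i` along the relabelled base point). [folklore] -/
theorem tubeHol_relabel {a : ℝ} (σ : Equiv.Perm (Fin (d + 1))) {G : (Fin (d + 1) → ℂ) → ℂ}
    (hG : TubeHol G (fun _ : Fin (d + 1) => a)) : TubeHol (relabel σ G) (fun _ : Fin (d + 1) => a) where
  periodic i p := by
    simp only [relabel_apply]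
    rw [Function.update_comp_equiv]
    have hp : p i = (p ∘ σ) (σ.symm i) := by simp
    rw [hp]
    exact hG.periodic (σ.symm i) (p ∘ σ)
  cont := by
    refine hG.cont.comp (continuous_pi fun μ => continuous_apply (σ μ)).continuousOn ?_
    intro p hp μ
    exact hp (σ μ)
  diff i q hq := by
    -- the complement of `j := σ⁻¹ i` is carried by `σ` into the complement of `i`
    have hne : ∀ k : Fin d, σ ((σ.symm i).succAbove k) ≠ i := by
      intro k h
      apply Fin.succAbove_ne (σ.symm i) k
      exact σ.injective (h.trans (σ.apply_symm_apply i).symm)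
    -- the relabelled line through `q` is the line through `q'` in the slot `σ⁻¹ i`
    have key : ∀ z : ℂ, (i.insertNth z q : Fin (d + 1) → ℂ) ∘ σ =
        (σ.symm i).insertNth z (fun k => (i.insertNth (0 : ℂ) q : Fin (d + 1) → ℂ) (σ ((σ.symm i).succAbove k))) := by
      intro z
      funext m
      by_cases hm : m = σ.symm i
      · subst hm
        simp [Fin.insertNth_apply_same]
      · obtain ⟨k, rfl⟩ := Fin.exists_succAbove_eq hm
        rw [Fin.insertNth_apply_succAbove, Function.comp_apply]
        obtain ⟨k', hk'⟩ := Fin.exists_succAbove_eq (hne k)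
        rw [← hk', Fin.insertNth_apply_succAbove, Fin.insertNth_apply_succAbove]
    have hq' : (fun k => (i.insertNth (0 : ℂ) q : Fin (d + 1) → ℂ) (σ ((σ.symm i).succAbove k))) ∈
        Tube (fun k => (fun _ : Fin (d + 1) => a) ((σ.symm i).succAbove k)) := by
      intro k
      obtain ⟨k', hk'⟩ := Fin.exists_succAbove_eq (hne k)
      simp only
      rw [← hk', Fin.insertNth_apply_succAbove]
      exact hq k'
    have h := hG.diff (σ.symm i) _ hq'
    refine h.congr fun z _ => ?_
    simp only [relabel_apply]
    rw [key z]

/-- **(L2)** the `x = 0` lattice kernel (the torus mean) is relabelling-invariant (Lebesgue measure on the box `[-π, π]^{d+1}` is invariant under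
the coordinate permutation `p ↦ p ∘ σ` = `MeasurableEquiv.arrowCongr' σ.symm (refl ℝ)`). [folklore] -/
theorem latticeKernel_relabel_zero (σ : Equiv.Perm (Fin (d + 1))) (G : (Fin (d + 1) → ℂ) → ℂ) :
    latticeKernel (relabel σ G) 0 = latticeKernel G 0 := by
  simp only [latticeKernel, B4ContourShift.fourierBox]
  congr 1
  have hint : ∀ p : Fin (d + 1) → ℝ,
      B4ContourShift.integrand (relabel σ G) 0 p = B4ContourShift.integrand G 0 (p ∘ σ) := by
    intro p
    simp only [B4ContourShift.integrand, relabel_apply, B4ContourShift.phase, Pi.zero_apply, Int.cast_zero, mul_zero,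
      Finset.sum_const_zero]
    rfl
  simp_rw [hint]
  -- `p ↦ p ∘ σ` is a volume-preserving measurable equivalence of the box onto itself
  set e : (Fin (d + 1) → ℝ) ≃ᵐ (Fin (d + 1) → ℝ) := MeasurableEquiv.arrowCongr' σ.symm (MeasurableEquiv.refl ℝ) with he_def
  have he : ∀ p : Fin (d + 1) → ℝ, e p = p ∘ σ := by
    intro p
    funext i
    simp [he_def, MeasurableEquiv.arrowCongr', Equiv.arrowCongr', Equiv.arrowCongr]
  have hmp : MeasureTheory.MeasurePreserving e MeasureTheory.volume MeasureTheory.volume :=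
    MeasureTheory.volume_preserving_arrowCongr' σ.symm (MeasurableEquiv.refl ℝ) (MeasureTheory.MeasurePreserving.id _)
  have hpre : e ⁻¹' (B4ContourShift.BZ (d + 1)) = B4ContourShift.BZ (d + 1) := by
    ext p
    simp only [Set.mem_preimage, he, B4ContourShift.BZ, Set.mem_Icc, Pi.le_def, Function.comp_apply]
    constructor
    · rintro ⟨h1, h2⟩
      exact ⟨fun i => by simpa using h1 (σ.symm i), fun i => by simpa using h2 (σ.symm i)⟩
    · rintro ⟨h1, h2⟩
      exact ⟨fun i => h1 (σ i), fun i => h2 (σ i)⟩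
  have h := hmp.setIntegral_preimage_emb e.measurableEmbedding (B4ContourShift.integrand G 0) (B4ContourShift.BZ (d + 1))
  rw [hpre] at h
  simp_rw [he] at h
  exact h

variable {b : ℕ → ℝ} {G : (Fin 4 → ℂ) → ℂ} {a κ M : ℝ}

/-- **THE GENERIC ANCHOR ON A RELABELLED code16 NODE SET** (engine convention `S_E` read through `σ`; for `σ = Equiv.swap 1 2` the node set is
`S′ = {w : 4 ∣ w₀+w₁+2w₂, 4 ∣ 2w₀+w₂+w₃}`, invariant under `R₂R₃` and `−1` ⇒ SYM4).  Binders exactly as `rowsOfCode16E_ofVertexTori₂` for `G`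
itself — (N) `hb`, STRUCTURE `hG`, (Z2) `hM` on `VertexTori κ`, (A) `hA₀`, cmp `hlo` — except that (T) is the certified ball for the node mean of
`G` over the RELABELLED nodes `gridPt (4N) (w ∘ σ)`, `w ∈ S_E`. [folklore] -/
def rowsOfCode16Relabel_ofVertexTori₂ (σ : Equiv.Perm (Fin 4)) (hb : b 0 = (latticeKernel G 0).re) (hκ : 0 < κ) (hκa : κ ≤ a)
    (hG : TubeHol G (fun _ => a)) (hM : ∀ p ∈ VertexTori (fun _ : Fin (3 + 1) => κ), ‖G p‖ ≤ M)
    {N : ℕ} (hN : 1 ≤ N) [NeZero (4 * N)] {t r : ℝ}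
    (hT : ‖((code16SetE N).card : ℂ)⁻¹ * (∑ w ∈ code16SetE N, descend G (gridPt (4 * N) (w ∘ σ))) - t‖ ≤ r)
    {A₀ : ℝ} (hA₀ : M * codeTheta (aliasRatioL1 κ N) ≤ A₀) (lo : ℚ) (hlo : ((lo : ℚ) : ℝ) ≤ t - r - A₀) : Rows b :=
  rowsOfCode16E_ofVertexTori₂ (G := relabel σ G) (by rw [latticeKernel_relabel_zero]; exact hb) hκ hκa (tubeHol_relabel σ hG)
    (bound_relabel_of_vertexTori σ hM) hN (by simpa only [descend_relabel_gridPt] using hT) hA₀ lo hlo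

end

end Summit.QuantumFields.BalabanUV.Beta.CapRowsRelabel
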